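import Summits.Ventures.Crystal3D.Theorems.StickyWulffConstantPolycrystalWulffBoundGenericTwoGrainFact
import Summits.Ventures.Crystal3D.Theorems.StickyWulffConstantPolycrystalWulffBoundWulffOverlapHyps
import Summits.Ventures.Crystal3D.Theorems.StickyWulffConstantPolycrystalWulffBoundNearTwinReduction

/-!
# `PolycrystalWulffBound`, line `PolyDensity`: the GENERIC TWO-GRAIN INEQUALITY at every wall constant
# `c ≥ 1` FROM the certified overlap constant CH-P1 (crux `stmt-Ventures-19482`; lane poly-p2, gen 23)

Route `StickyWulffConstant` of the venture `Summits/Ventures/Crystal3D`, second prover lane.  Lane P's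
named fact `GenericTwoGrainInequality c` (`…GenericTwoGrainFact`, poly-p2 g18: for every NON-co-axial
pair of crux frames `A, B` and every disjoint polyhedral finite-volume pair `S₁, S₂`,
`6·2^{1/3}(√2|S₁ ∪ S₂|)^{2/3} ≤ [Per_{W A} S₁ − ι_{W A}(S₁,S₂)] + [Per_{W B} S₂ − ι_{W B}(S₂,S₁)] +
c·ι_{Dsc 0}(S₁,S₂)`) is, at the v4 wall constant `c = 1` of the crux text — and hence at every `c ≥ 1` —
NOT an independent fact: it is the `n = 2` instance of the landed two-class twin-free rung
`rung_twinFree_twoClasses_of_WulffOverlap27_5` (poly-p2 g3/g4, p578755: dominant class by relabelling,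
balanced classes by the intersection-body Wulff inequality `Fr ≥ 3|W A ∩ W B|^{1/3}|E|^{2/3}` against the
merged-class pincer).  So

* `genericTwoGrainInequality_of_WulffOverlap27_5` : **CH-P1 ⟹ `GenericTwoGrainInequality c` for all
  `c ≥ 1`**, where CH-P1 = `WulffOverlap27_5` = «`∀ R, 27.5 ≤ |W(1) ∩ W(R)|`» is the pairwise overlap
  constant of the fcc Wulff body (computational grade: kit j292055, Lipschitz–Steiner branch and bound,
  14.7 M exact polytope volumes, 450 s wall; true minimum `27.9013` at the 90° rotation about `⟨110⟩`;
  HOME/poly-p2/CERT-wulffOverlap-27.5.md, evidence #13 on the crux item);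
* `genericTwoGrainInequality_of_WulffOverlap27_8` : the same from CH-P1′ (`27.8`, the constant of the
  all-classes rung).

READING (for the record of lane P's «certified ∀R column at c₀ = 1», memo C1-COST-g21 / BOX1-g20, steward
DECISION Q4): the bankable corollary of that column — the law-v4 generic two-grain wall inequality for
EVERY misorientation — already follows in the kernel from CH-P1 alone (this file, ≈ 100 lines, no kit),
with no per-`R` calibration theorem in between.  The box-certificate column keeps a value only as an
independent, method-different lineage (Knothe discrepancy `D̄_F(R) < 1`) and as the engine for wall
constants `c < 1`, where the two-class overlap LP does NOT close (eliminating the wall area between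
`En ≥ 3κ^{1/3}|E|^{2/3} + c·𝒜` and `En ≥ w(v₁) + w(v₂) − (2√5 − c)·𝒜` needs
`(2√5 − c)(κ/32)^{1/3} + ((17/20)^{2/3} + (3/20)^{2/3})·c ≥ 2√5`; at V5's `c = 13/25` this asks `κ ≥ 29.8`,
above the true minimum `27.90`).
WHAT THIS IS NOT: a proof of CH-P1 (hypothesis, certified numerically); anything at `c < 1` (V5's `13/25`);
the all-generic MULTI-lattice class is the separate rung `rung_twinFree_allClasses_of_WulffOverlap27_8`
(mod CH-P1′ and the kernel-evaluated `AggCert27_8`); mixed twin + generic textures; the crux is not claimed.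
-/

noncomputable section

open scoped BigOperators InnerProductSpace ENNReal
open MeasureTheory Set

namespace Summit.Ventures.Crystal3D.Cruxes.PolycrystalWulffBound.PolyDensity

open Summit.Ventures.Crystal3D.Theorems
open Summit.Ventures.Crystal3D.Cruxes.TextureLiminf.TexShadow (E3)

/-- **CH-P1 ⟹ the generic two-grain inequality at every wall constant `c ≥ 1`.**  For a non-co-axial
pair of crux frames `(A, B)` and a disjoint polyhedral finite-volume pair `(S₁, S₂)`, the two-grain
texture `![S₁, S₂]` with frames `![A, B]`, all charges `c` and all axes `0` is a crux texture (finite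
perimeter by `hasFinitePerimeter_of_poly`; its only distinct pair is generic, so the twin-free clause and
the «at most two lattices» clause are automatic), and `rung_twinFree_twoClasses_of_WulffOverlap27_5`
applied to it is, after unfolding the `n = 2` sums, exactly the conclusion of `GenericTwoGrainInequality c`. -/
theorem genericTwoGrainInequality_of_WulffOverlap27_5 (hCH : WulffOverlap27_5) {c : ℝ} (hc : 1 ≤ c) :
    GenericTwoGrainInequality c := by
  unfold GenericTwoGrainInequality
  intro Λ Brl Ax CoAx Φ Per ι W Dsc Poly A B hAB S₁ S₂ hP₁ hP₂ hv₁ hv₂ hd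
  classical
  -- the two-grain texture
  set G : Fin 2 → Set E3 := ![S₁, S₂] with hG
  set A' : Fin 2 → (E3 ≃ₗᵢ[ℝ] E3) := ![A, B] with hA'
  have hG0 : G 0 = S₁ := rfl
  have hG1 : G 1 = S₂ := rfl
  have hA0 : A' 0 = A := rfl
  have hA1 : A' 1 = B := rfl
  have h01 : (0 : Fin 2) ≠ 1 := by decide
  -- co-axiality is symmetric
  have hCoAx_symm : ∀ (X Y : E3 ≃ₗᵢ[ℝ] E3), CoAx X Y → CoAx Y X := by
    intro X Y hXY
    obtain ⟨m, L, s₁, s₂, σ, σ', hσ, hσ', hL, h1, h2⟩ := hXY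
    exact ⟨m, L, s₂, s₁, σ', σ, hσ', hσ, hL, h2, h1⟩
  -- no distinct pair of the texture is co-axial
  have hnc : ∀ f g : Fin 2, f ≠ g → ¬ CoAx (A' f) (A' g) := by
    intro f g hfg
    fin_cases f <;> fin_cases g
    · exact absurd rfl hfg
    · exact hAB
    · exact fun h => hAB (hCoAx_symm _ _ h)
    · exact absurd rfl hfg
  -- the texture clause
  have hTex : (∀ f : Fin 2, Literature.MathematicalPhysics.StatisticalMechanics.HasFinitePerimeter (G f) ∧
        volume (G f) < ⊤) ∧
      (∀ f g : Fin 2, f ≠ g → Disjoint (G f) (G g)) ∧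
      (∀ f g : Fin 2, f ≠ g → (0 : ℝ) ≤ (fun _ _ : Fin 2 => c) f g) ∧
      (∀ f g : Fin 2, f ≠ g → ¬ CoAx (A' f) (A' g) →
        (fun _ _ : Fin 2 => (0 : E3)) f g = 0 ∧ (1 : ℝ) ≤ (fun _ _ : Fin 2 => c) f g) ∧
      (∀ f g : Fin 2, f ≠ g → CoAx (A' f) (A' g) → A' f '' Λ ≠ A' g '' Λ →
        Ax ((fun _ _ : Fin 2 => (0 : E3)) f g) (A' f) (A' g) ∧ (1 : ℝ) / 2 ≤ (fun _ _ : Fin 2 => c) f g) := by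
    refine ⟨?_, ?_, ?_, ?_, ?_⟩
    · intro f
      fin_cases f
      · exact ⟨hasFinitePerimeter_of_poly hP₁ hv₁, hv₁⟩
      · exact ⟨hasFinitePerimeter_of_poly hP₂ hv₂, hv₂⟩
    · intro f g hfg
      fin_cases f <;> fin_cases g
      · exact absurd rfl hfg
      · exact hd
      · exact hd.symm
      · exact absurd rfl hfg
    · intro f g _
      show (0 : ℝ) ≤ c
      linarith
    · intro f g _ _
      exact ⟨rfl, hc⟩
    · intro f g hfg hco _
      exact absurd hco (hnc f g hfg)
  have hPoly : ∀ f : Fin 2, Poly (G f) := by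
    intro f
    fin_cases f
    · exact hP₁
    · exact hP₂
  have hTF : ∀ f g : Fin 2, f ≠ g → CoAx (A' f) (A' g) → A' f '' Λ = A' g '' Λ :=
    fun f g hfg hco => absurd hco (hnc f g hfg)
  have hTwo : ∀ f g h : Fin 2, A' f '' Λ = A' g '' Λ ∨ A' g '' Λ = A' h '' Λ ∨ A' f '' Λ = A' h '' Λ := by
    intro f g h
    fin_cases f <;> fin_cases g <;> fin_cases h <;> simp
  -- the two-class rung on the two-grain texture
  have key : 6 * (2 : ℝ) ^ ((1 : ℝ) / 3) * (Real.sqrt 2 * (volume (⋃ f : Fin 2, G f)).toReal) ^ ((2 : ℝ) / 3) ≤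
      ∑ f : Fin 2, Per (W (A' f)) (G f) -
        ∑ f : Fin 2, ∑ g : Fin 2, (if f = g then 0 else ι (W (A' f)) (G f) (G g)) +
        ∑ f : Fin 2, ∑ g : Fin 2,
          (if f = g then 0 else (fun _ _ : Fin 2 => c) f g / 2 *
            ι (Dsc ((fun _ _ : Fin 2 => (0 : E3)) f g)) (G f) (G g)) :=
    rung_twinFree_twoClasses_of_WulffOverlap27_5 hCH 2 G A' (fun _ _ => c) (fun _ _ => (0 : E3))
      hTex hPoly hTF hTwo
  -- unfold the `n = 2` sums
  have hU : (⋃ f : Fin 2, G f) = S₁ ∪ S₂ := by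
    ext x
    simp only [mem_iUnion, Fin.exists_fin_two, hG0, hG1, mem_union]
  have hEn : (∑ f : Fin 2, Per (W (A' f)) (G f) -
        ∑ f : Fin 2, ∑ g : Fin 2, (if f = g then 0 else ι (W (A' f)) (G f) (G g)) +
        ∑ f : Fin 2, ∑ g : Fin 2,
          (if f = g then 0 else (fun _ _ : Fin 2 => c) f g / 2 *
            ι (Dsc ((fun _ _ : Fin 2 => (0 : E3)) f g)) (G f) (G g))) =
      (Per (W A) S₁ - ι (W A) S₁ S₂) + (Per (W B) S₂ - ι (W B) S₂ S₁) + c * ι (Dsc 0) S₁ S₂ := by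
    simp only [ι, Fin.sum_univ_two, Fin.isValue, if_true, if_false, h01, h01.symm, hG0, hG1, hA0, hA1,
      Set.union_comm S₂ S₁]
    ring
  rw [hU, hEn] at key
  exact key

/-- **CH-P1′ ⟹ the generic two-grain inequality at every `c ≥ 1`** (the `27.8` constant of the
all-classes twin-free rung implies CH-P1). -/
theorem genericTwoGrainInequality_of_WulffOverlap27_8 (hCH : WulffOverlap27_8) {c : ℝ} (hc : 1 ≤ c) :
    GenericTwoGrainInequality c :=
  genericTwoGrainInequality_of_WulffOverlap27_5 hCH.to27_5 hc

end Summit.Ventures.Crystal3D.Cruxes.PolycrystalWulffBound.PolyDensity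

end
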